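import Summits.QuantumFields.YangMills.Theorems.BalabanUVNodesN14YoungRateByName
import Summits.QuantumFields.YangMills.Theorems.BalabanUVNodesN19InEdgesAtRecord
import Literature.MathematicalPhysics.QuantumFieldTheory.Balaban1983to89.T4TowerRateComposition

/-!
# BalabanUVNodes ∕ node N14 = NE1′ — road (ii)'s young rate WITH THE TWO BRACKETS BY NAME: the coupling bracket from N17 · (D4) · N18 · N22
# (`N19InEdgesAtRecord.injectedRate_of_n17At_readOutAt` ⊛ fading memory), the argument bracket from N16's liaison letters
# (`NE3Shape ∧ GaugeDominated` ⊛ `PolyLipGrowth`), and the capstone `∃ η, TiltedMeanMatching … η ∧ Summable η` from `RatesAt D R` read at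
# N14 · N17 · N18 · N22 plus (D4) and the NE3 liaison — the road-(ii) twin of `N19RateEdge.rateEdge_of_linkReading` (p421499)

Cell `pub-ymgap`, HUMAN RULINGS D-0062∕D-0088, director-ym R141 (C), seat `pub-ymgap-dag-n14-e` (FAN-OUT v1.1 §N14 s3 — ALTERNATIVE CURRENCY),
generation 0, module 2; route `Summits/QuantumFields/YangMills/Theses/BalabanUVNodes.lean` rev 6 (K3 `SpineGivenEndpointR11`, `--supports
stmt-QuantumFields-19676`); venue ruling R424.  THEOREMS ONLY; imports this seat's module 1 `BalabanUVNodesN14YoungRateByName` (p454446), seat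
n19-a's `BalabanUVNodesN19InEdgesAtRecord` (the consumer-side conversions of N17 and N16) and the tree's `T4TowerRateComposition` (the bracket
algebra `historySum_le_rate_of_lt`, `couplingRate_pair_of_injectedDisc`, `argBracket_tower`) ONLY; modifies nothing; every cited lemma is used
BY NAME.

WHY THIS FILE.  Module 1 fed the displayed binder `YoungInfluenceRate` of N14's residual road from `N18At` ∕ `N22At` BY NAME, leaving the argument
bracket `CU·gauge ≤ a·ρ^j` and the coupling bracket `Σ_{i<j} Λ j i |gA i − gB i| ≤ b·ρ^j` DISPLAYED «at rate».  On road (i) seat n19-a converts the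
other two siblings into exactly these brackets' inputs: `N17At D u` (+ (D4) `ReadOutAt D u`, N18, N22, the (0.20)-run identification, the
infrared pin, the β-window) ⟶ node U2's output `InjectedRate (2crC₅θ∕(1−ρ)) 0 ρ (disc (g K) (g (K+1)))`
(`N19InEdgesAtRecord.injectedRate_of_n17At_readOutAt`), and `N16At c` (+ THE END's regime letters) ⟶ `NE3Shape Rd C₃ θ₃ ∧ GaugeDominated Rd uA uB`
(`N19InEdgesAtRecord.ne3Liaison_of_covRoot`).  THIS FILE composes those outputs with the tree's bracket algebra, so that road (ii) consumes
`RatesAt D R` at N14 · N16 · N17 · N18 · N22 BY NAME (N16 in two steps: its liaison letters `NE3Shape ∧ GaugeDominated` first, then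
`N16At` itself through `ne3Liaison_of_covRoot` with its END letters displayed verbatim):
* §1 **`couplingBracket_of_n17At_readOutAt`** [bookkeeping]: `N17At D u`, `ReadOutAt D u`, `N18At u`, `N22At u` BY NAME + the (0.20)-run
  identification `∀ K, RGEqH K D.βfun (g K)`, the box `0 < g K i ≤ u.γ`, the infrared pin `g K K = gIR`, `EventualLowerH bβ u.γ k₀β D.βfun`, the
  window `cr·C₉·ω·((k₀β+1)γ³ + 2γ∕bβ) ≤ (1−ρ)∕2`, `0 < u.ρ < 1`, `0 < u.γ`, `0 < bβ`, and ANY rate `ρ′ > max(u.ω, u.ρ)` ⇒ for every cutoff `K`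
  and `j ≤ K`: `Σ_{i<j} u.Λ j i |g K i − g (K+1) (i+1)| ≤ b·ρ′^j` with the EXPLICIT `b = u.C₉·(γ³·Cd)·ρ′∕(ρ′ − max(ω,ρ))`,
  `Cd = 2(cr·C₅·θ)∕(1−ρ)` — `injectedRate_of_n17At_readOutAt` ∘ `couplingRate_pair_of_injectedDisc` ∘ `historySum_le_rate_of_lt` (fading memory
  = `N22At`.2).
* §2 **`argBracket_of_ne3Shape_gaugeDominated`** [bookkeeping]: `NE3Shape Rd C₃ θ₃` ∧ `GaugeDominated Rd uA uB` (N16's liaison letters on a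
  readings family) + `PolyLipGrowth CU g P q` (the (T)-bracket growth letter, displayed on road (i) too), `0 ≤ C₃, P`, any `ρ′ ≥ θ₃` ⇒
  `∃ a ≥ 0, ∀ K, ∀ v ∈ Rd.dom, ∀ j ≤ K, CU (g K) j · gauge (uA K v) (transport (uB K v)) ≤ a·ρ′^j` — `T4RateLiaison.gauge_le_of_localRate` ∘
  `T4TowerRateComposition.argBracket_tower`.
* §3 **`youngInfluenceRate_of_readings`** [bookkeeping]: module 1's §1 with the backgrounds INDEXED BY A READINGS FAMILY `v ∈ dom` and the two-run
  domination in UNIFORM form — «every nonnegative uniform bound `M` of `|EA (gA K) (uA K v) (δ X) − EB (gB K) (uB K v) (δ X)|` over `v ∈ dom`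
  dominates `|ΔB X − ΔA X| ≤ wt X·M`» (the integrated influence of a slot is at most its weight times the sup over the fluctuation data of the
  two runs' dressed-piece discrepancy; NODE O's, displayed) ⇒ `YoungInfluenceRate … vol (Cw·(a+b+C₅)) ρ Λ`.
* §4 **`tiltedMeanMatching_summable_of_ratesAt_liaison`** [bookkeeping] — THE CAPSTONE WITH FOUR SIBLINGS BY NAME (and
  **`tiltedMeanMatching_summable_of_ratesAt_byName`**: FIVE — N16 itself through `ne3Liaison_of_covRoot` with its ≈ 40 displayed inputs): `RatesAt Dt R` read at `.1`
  (N14: both one-run old budgets, n14-a's `tiltedMeanMatching_summable_of_n14`), `.2.2.2.1` (N17), `.2.2.2.2.1` (N18), `.2.2.2.2.2` (N22), plus (D4)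
  `ReadOutAt Dt R.u3` (K4's `S_D4` letter; it also supplies the letter signs `0 ≤ cr, C₅, θ, ω`, `θ, ω ≤ ρ`), the NE3 liaison letters, `PolyLipGrowth`,
  `LipBackground`, the (0.20)-run identification ∕ pin ∕ β-window, the window memberships of both re-indexed tables, the first-coupling selector,
  the `ScaleLedger`, n14-a's one-run identifications, §3's uniform two-run domination, ONE census at `R.ne1.Λ`, a rate `ρ′` with
  `max(ω, ρ) < ρ′ < 1`, `θ₃ ≤ ρ′ ≤ R.ne1.Λ`, `0 ≤ u.κ`, `Summable w` ⇒ `∃ η, TiltedMeanMatching l₀ T Bad F ν F′ ν′ η ∧ Summable η`.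

HONEST FRAMING.  Count-neutral kernel bookkeeping BY NAME over hypothesis SHAPES; 0 `def`, 0 `sorry`, standard axioms; NE1′, NE3, NE4, NE5, NE9, NE7
NOT PRINTED ∕ NOT proved; nothing of Bałaban's is asserted or instantiated; every identification ∕ domination ∕ census ∕ liaison letter is a
DISPLAYED binder discharged by nobody (NODE O ∕ other rows ∕ the record predicate); `RateCarriers`, `Datum` are PARAMETERS; N14 ∕ N16 ∕ N17 NOT
discharged.  One finite four-torus at fixed ε — NOT infinite volume, NOT OS on ℝ⁴, NOT a mass gap, NOT Clay.
-/

set_option autoImplicit false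

noncomputable section

namespace YMDAG.N14YoungRate

open Finset MeasureTheory
open scoped BigOperators Matrix Matrix.Norms.L2Operator
open Literature.MathematicalPhysics.QuantumFieldTheory.Balaban1983to89
open Literature.MathematicalPhysics.QuantumFieldTheory.Balaban1983to89.T4OutputRate
  (Carriers Functional NE5 NE9 LipBackground FadingMemory)
open Literature.MathematicalPhysics.QuantumFieldTheory.Balaban1983to89.T4RecentScale (Multiplicity)
open Literature.MathematicalPhysics.QuantumFieldTheory.Balaban1983to89.T4EtaRateMin (Readings NE3Shape)
open Literature.MathematicalPhysics.QuantumFieldTheory.Balaban1983to89.T4RateLiaison (GaugeDominated gauge_le_of_localRate)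
open Literature.MathematicalPhysics.QuantumFieldTheory.Balaban1983to89.T4TowerRateComposition
  (PolyLipGrowth argBracket_tower historySum_le_rate_of_lt couplingRate_pair_of_injectedDisc)
open Literature.MathematicalPhysics.QuantumFieldTheory.Balaban1983to89.T4CouplingMatching (EventualLowerH)
open Literature.MathematicalPhysics.QuantumFieldTheory.Balaban1983to89.FlowStep (RGEqH)
open Summit.QuantumFields.BalabanUV.T4Continuum.NE1p.DressedRoot (DressedTower DressedStabilityStrict)
open Summit.QuantumFields.BalabanUV.T4Continuum.NE1p.DressedMGFForm (tiltedMean TiltedMeanMatching)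
open Summit.QuantumFields.BalabanUV.T4Continuum.NE1p.TiltedMeanCrossover (ScaleLedger YoungInfluenceRate)
open Summit.QuantumFields.BalabanUV.T4Continuum
open AveragingDeficitDualResidual (dualC1 dualC2)
open AveragingDeficitDerivWallProof (wallConst)
open AveragingDeficitPeriodicCounting (IsPeriodicDir)
open MinimalActionSandwich (IsMinimiser minAct)
open MinimalActionRate (sfClass)
open MinimalActionRefine (RegularSup gradConst)
open NE3EnergyShapes (IsUnitarySite IsPeriodicSite)
open NE3.LeafIndexSockets (LeafH3sup)
open Summit.QuantumFields.YangMills.BalabanUVNodes.N19InEdgesAtRecord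
  (injectedRate_of_n17At_readOutAt histCompanions_of_readOutAt ne3Liaison_of_covRoot)
open YMDAG.UVSplit (U3Carriers RateCarriers N14At N16At N17At N18At N22At ReadOutAt RatesAt)

/-! ## §1 The coupling bracket BY NAME from N17 · (D4) · N18 · N22 -/

section Coupling

variable {Fam : T4Continuum.T4Family} {N : ℕ} [NeZero N]

/-- **THE COUPLING BRACKET AT RATE, FROM N17 · (D4) · N18 · N22 BY NAME** [bookkeeping].  Node U2's output on the record's coupling tables
(`injectedRate_of_n17At_readOutAt`: `disc (g K) (g (K+1)) j ≤ Cd·ρ^j`, `Cd = 2(cr·C₅·θ)∕(1−ρ)`), read on the box as the coupling rate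
`|g K i − g (K+1) (i+1)| ≤ γ³·Cd·ρ^i` (`couplingRate_pair_of_injectedDisc`), composed with the fading memory of the OUTPUT moduli (`N22At`.2) at any
separated rate `ρ′ > max(ω, ρ)` (`historySum_le_rate_of_lt`): for every cutoff `K` and every `j ≤ K`,
`Σ_{i<j} u.Λ j i·|g K i − g (K+1) (i+1)| ≤ u.C₉·(u.γ³·Cd)·(ρ′∕(ρ′ − max(u.ω, u.ρ)))·ρ′^j`.  (Precedent composition of the same three
lemmas, for the field-independent constants instead of the bracket and with N17's inputs displayed: `N19CentreSync.abs_const_sub_le_tower`.)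
[folklore] -/
theorem couplingBracket_of_n17At_readOutAt (Dt : YMDAG.UVSplit.Datum Fam N) (u : U3Carriers) (h17 : N17At Dt u)
    (hD4 : ReadOutAt Dt u) (h18 : N18At u) (h22 : N22At u) {g : ℕ → ℕ → ℝ} {gIR bβ : ℝ} {k₀β : ℕ} (hγ : 0 < u.γ)
    (hbβ : 0 < bβ) (hρ0 : 0 < u.ρ) (hρ1 : u.ρ < 1) (hrun : ∀ K, RGEqH K Dt.βfun (g K))
    (hbox : ∀ K i, i ≤ K → 0 < g K i ∧ g K i ≤ u.γ) (hpin : ∀ K, g K K = gIR) (hlo : EventualLowerH bβ u.γ k₀β Dt.βfun)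
    (hsmall : u.cr * u.C₉ * u.ω * (((k₀β : ℝ) + 1) * u.γ ^ 3 + 2 * u.γ / bβ) ≤ (1 - u.ρ) / 2) {ρ' : ℝ}
    (hρ' : max u.ω u.ρ < ρ') :
    ∀ K, ∀ j ≤ K, ∑ i ∈ range j, u.Λ j i * |g K i - g (K + 1) (i + 1)| ≤
      u.C₉ * (u.γ ^ 3 * (2 * (u.cr * u.C₅ * u.θ) / (1 - u.ρ))) * (ρ' / (ρ' - max u.ω u.ρ)) * ρ' ^ j := by
  intro K j hj
  have hinj := injectedRate_of_n17At_readOutAt Dt h17 hD4 h18 h22 hγ hbβ hρ0 hρ1 hrun hbox hpin hlo hsmall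
  obtain ⟨𝒜A, 𝒜B, rA, rB, -, -, -, -, -, -, -, hcr, hC₅, hθ, hω, -, -⟩ := hD4
  have hCd : 0 ≤ 2 * (u.cr * u.C₅ * u.θ) / (1 - u.ρ) :=
    div_nonneg (mul_nonneg zero_le_two (mul_nonneg (mul_nonneg hcr hC₅) hθ)) (by linarith)
  have hD : 0 ≤ u.γ ^ 3 * (2 * (u.cr * u.C₅ * u.θ) / (1 - u.ρ)) := mul_nonneg (pow_nonneg hγ.le 3) hCd
  exact historySum_le_rate_of_lt (gA := g K) (gB := fun n => g (K + 1) (n + 1)) h22.2 hω hρ0.le hD hρ'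
    fun i hi => couplingRate_pair_of_injectedDisc hinj hbox K i (by omega)

end Coupling

/-! ## §2 The argument bracket BY NAME from N16's liaison letters -/

section Argument

variable {ι' X' : Type} {Car : Carriers}

/-- **THE ARGUMENT BRACKET AT RATE, FROM THE NE3 LIAISON LETTERS** [bookkeeping].  `NE3Shape Rd C₃ θ₃` (N16 in readings form: local rate
`θ₃^K` at run level `K`, `0 ≤ θ₃ < 1`) and the realisation convention `GaugeDominated Rd uA uB` give the closeness `gauge (uA K v) (transport (uB K v))
≤ C₃·θ₃^K` (`T4RateLiaison.gauge_le_of_localRate`); with the growth letter `PolyLipGrowth CU g P q` of the Lipschitz-in-U constant the factor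
`θ₃^{K−j}` pays for the growth (`T4TowerRateComposition.argBracket_tower`): ONE `a ≥ 0` with `CU (g K) j · gauge ≤ a·ρ′^j` for all `K`, all
`v ∈ Rd.dom`, all `j ≤ K`, at any rate `ρ′ ≥ θ₃`. [folklore] -/
theorem argBracket_of_ne3Shape_gaugeDominated (Rd : Readings ι' X') {C₃ θ₃ : ℝ} (h3 : NE3Shape Rd C₃ θ₃) (hC₃ : 0 ≤ C₃)
    {uA : ℕ → ι' → Car.BgA} {uB : ℕ → ι' → Car.BgB} (hgd : GaugeDominated Rd uA uB) {CU : (ℕ → ℝ) → ℕ → ℝ}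
    {g : ℕ → ℕ → ℝ} {P : ℝ} {q : ℕ} (hG : PolyLipGrowth CU g P q) (hP : 0 ≤ P) {ρ' : ℝ} (hθ₃ρ : θ₃ ≤ ρ') :
    ∃ a : ℝ, 0 ≤ a ∧ ∀ K, ∀ v ∈ Rd.dom, ∀ j ≤ K, CU (g K) j * Car.gauge (uA K v) (Car.transport (uB K v)) ≤ a * ρ' ^ j := by
  obtain ⟨a, ha0, ha⟩ := argBracket_tower (δc := fun K => C₃ * θ₃ ^ K) hG hP hC₃ h3.rate_nonneg h3.rate_lt_one hθ₃ρ
    (fun K => mul_nonneg hC₃ (pow_nonneg h3.rate_nonneg K)) (fun K => le_rfl)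
  refine ⟨a, ha0, fun K v hv j hj => ?_⟩
  have hclose : Car.gauge (uA K v) (Car.transport (uB K v)) ≤ C₃ * θ₃ ^ K := gauge_le_of_localRate h3.pointwise hgd K hv
  exact (mul_le_mul_of_nonneg_left hclose (hG K j hj).1).trans (ha K j hj)

end Argument

/-! ## §3 The young rate with backgrounds indexed by a readings family and UNIFORM two-run domination -/

section Readings

variable {C : Carriers} {ι D : Type*} [DecidableEq ι] {l₀ vol : ℝ} {T : ℕ → Finset ι} {Bad : ℕ → ℝ → Finset ι}
  {wf : ℕ → ι → Finset D} {sc : ℕ → D → ℕ} {ΔA ΔB : ℕ → ℝ → ι → ℝ → D → ℝ}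

/-- **THE YOUNG RATE, READINGS-INDEXED BACKGROUNDS, UNIFORM DOMINATION** [bookkeeping].  As module 1's `youngInfluenceRate_of_u3Letters`, but the
two runs' backgrounds are families `uA K v`, `uB K v` over fluctuation data `v ∈ dom`, the brackets hold for every `v ∈ dom`, and the two-run
domination is UNIFORM: for every slot and every `M ≥ 0`, if `|EA (gA K) (uA K v) (δ X) − EB (gB K) (uB K v) (δ X)| ≤ M` for all `v ∈ dom` then
`|ΔB X − ΔA X| ≤ wt X·M` (the integrated influence difference is at most the weight times the sup of the integrand's two-run discrepancy — NODE O's,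
displayed).  THEN `YoungInfluenceRate l₀ T Bad wf sc ΔA ΔB vol (Cw·(a + b + C₅)) ρ Λ`. [folklore] -/
theorem youngInfluenceRate_of_readings {V : Type*} {W : Set (ℕ → ℝ)} {EA : Functional C C.BgA} {EB : Functional C C.BgB}
    {κ ρ C₅ : ℝ} {Λ9 : ℕ → ℕ → ℝ} {CU : (ℕ → ℝ) → ℕ → ℝ}
    (h9 : NE9 EA W κ Λ9) (hU : LipBackground EA W κ CU) (h5 : NE5 EA EB W κ ρ C₅) (hκ : 0 ≤ κ)
    (wt : ℕ → ι → D → ℝ) {Cw Λ : ℝ} (hM : ∀ K, ∀ τ ∈ T K, Multiplicity (wf K τ) (sc K) (wt K τ) Cw vol Λ K)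
    (δ : ∀ (K : ℕ) (t : ℝ) (τ : ι) (s : ℝ), D → C.Dom) (hδ : ∀ K t τ s, ∀ X ∈ wf K τ, C.scale (δ K t τ s X) = sc K X)
    (gA gB : ℕ → ℕ → ℝ) (hgA : ∀ K, gA K ∈ W) (hgB : ∀ K, gB K ∈ W) (hCU : ∀ K, ∀ j ≤ K, 0 ≤ CU (gA K) j)
    (dom : Set V) (uA : ℕ → V → C.BgA) (uB : ℕ → V → C.BgB)
    (hdomU : ∀ K (t : ℝ), |t| ≤ l₀ → ∀ τ ∈ T K \ Bad K t, ∀ s : ℝ, |s| ≤ l₀ → ∀ X ∈ wf K τ, ∀ M : ℝ, 0 ≤ M →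
      (∀ v ∈ dom, |EA (gA K) (uA K v) (δ K t τ s X) - EB (gB K) (uB K v) (δ K t τ s X)| ≤ M) →
      |ΔB K t τ s X - ΔA K t τ s X| ≤ wt K τ X * M)
    {a b : ℝ} (harg : ∀ K, ∀ v ∈ dom, ∀ j ≤ K, CU (gA K) j * C.gauge (uA K v) (C.transport (uB K v)) ≤ a * ρ ^ j)
    (hcpl : ∀ K, ∀ j ≤ K, ∑ i ∈ range j, Λ9 j i * |gA K i - gB K i| ≤ b * ρ ^ j)
    (ha0 : 0 ≤ a) (hb0 : 0 ≤ b) (hC₅ : 0 ≤ C₅) (hρ : 0 ≤ ρ) :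
    YoungInfluenceRate l₀ T Bad wf sc ΔA ΔB vol (Cw * (a + b + C₅)) ρ Λ := by
  intro K t ht τ hτ s hs j hj
  have hτT : τ ∈ T K := (mem_sdiff.mp hτ).1
  have hσ : 0 ≤ (a + b + C₅) * ρ ^ j := mul_nonneg (by linarith) (pow_nonneg hρ _)
  have hdom' : ∀ X ∈ wf K τ, sc K X = j → |ΔB K t τ s X - ΔA K t τ s X| ≤ wt K τ X * ((a + b + C₅) * ρ ^ j) := by
    intro X hX hXj
    have hscX : C.scale (δ K t τ s X) = j := (hδ K t τ s X hX).trans hXj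
    refine hdomU K t ht τ hτ s hs X hX _ hσ fun v hv => ?_
    -- one slot, one fluctuation datum: module 1's three-brackets lemma with unit weight
    have h := abs_sub_le_of_dom_threeBrackets h9 hU h5 hκ (hgA K) (hgB K) (uA K v) (uB K v) (δ K t τ s X)
      (by rw [hscX]; exact hCU K j hj) (a := a) (b := b) (by rw [hscX]; exact harg K v hv j hj)
      (by rw [hscX]; exact hcpl K j hj) ha0 hb0 hC₅ hρ zero_le_one
      (x := EB (gB K) (uB K v) (δ K t τ s X)) (y := EA (gA K) (uA K v) (δ K t τ s X)) (by rw [one_mul])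
    rw [hscX, one_mul] at h
    exact h
  calc ∑ X ∈ wf K τ with sc K X = j, |ΔB K t τ s X - ΔA K t τ s X|
      ≤ (a + b + C₅) * ρ ^ j * (Cw * vol * Λ ^ (K - j)) :=
        slice_abs_sub_le_of_dom (wf K τ) (sc K) (ΔA K t τ s) (ΔB K t τ s) (wt K τ) j hdom' hσ (hM K τ hτT j hj)
    _ = vol * (Cw * (a + b + C₅) * (ρ ^ j * Λ ^ (K - j))) := by ring

end Readings

/-! ## §4 The capstone on road (ii) with N14 · N16-liaison · N17 · N18 · N22 · (D4) BY NAME -/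

section Capstone

variable {Fam : T4Continuum.T4Family} {N : ℕ} [NeZero N] {ι D : Type*} [DecidableEq ι] {Ω Ω' : ℕ → Type*}
  [∀ K, MeasurableSpace (Ω K)] [∀ K, MeasurableSpace (Ω' K)] {l₀ vol : ℝ} {T : ℕ → Finset ι} {Bad : ℕ → ℝ → Finset ι}
  {F : ∀ K, Ω K → ℝ} {ν : ∀ K, ι → Measure (Ω K)} {F' : ∀ K, Ω' K → ℝ} {ν' : ∀ K, ι → Measure (Ω' K)} {wf : ℕ → ι → Finset D}
  {sc : ℕ → D → ℕ} {bA bB : ℕ → ℝ → ι → ℝ → ℝ} {ΔA ΔB : ℕ → ℝ → ι → ℝ → D → ℝ} {w : ℕ → ℝ}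

/-- **`RatesAt Dt R` AT N14 · N17 · N18 · N22, (D4), AND N16's LIAISON LETTERS ⇒ `∃ η, TiltedMeanMatching … η ∧ Summable η`** [bookkeeping].
Read: `.1` N14 serves both one-run old budgets (n14-a's `YMDAG.N14.tiltedMeanMatching_summable_of_n14` BY NAME: `ScaleLedger`, volume weights,
ONE census at `R.ne1.Λ`, the two one-run identifications ∕ dominations by booked sizes of `R.ne1.𝒯`); `.2.2.2.1` N17 + (D4) `ReadOutAt Dt R.u3` +
`.2.2.2.2.1` N18 + `.2.2.2.2.2` N22 serve the coupling bracket (§1; (0.20)-run identification, box, infrared pin, `EventualLowerH`, window) and NE5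
for run B's selected family; N16's liaison letters `NE3Shape Rd C₃ θ₃ ∧ GaugeDominated Rd uA uB` + `PolyLipGrowth CU g P q` serve the argument
bracket (§2); the bracket (T) `LipBackground`; §3's uniform two-run domination with the slots' U3 domains `δ`; a rate `ρ′` with
`max(u.ω, u.ρ) < ρ′ < 1`, `θ₃ ≤ ρ′`, `ρ′ ≤ R.ne1.Λ`; `0 ≤ u.κ`, `0 ≤ C₃, P, Cw, vol`, `Summable w`.  Letter signs `0 ≤ cr, C₅, θ, ω` and `θ ≤ ρ`
are READ from (D4).  NOT NE7; nothing discharged. [folklore] -/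
theorem tiltedMeanMatching_summable_of_ratesAt_liaison (Dt : YMDAG.UVSplit.Datum Fam N) (R : RateCarriers N)
    (hrates : RatesAt Dt R) (hD4 : ReadOutAt Dt R.u3)
    -- the consumer's ledger and ONE census at N14's rate
    (hL : ScaleLedger l₀ T Bad F ν F' ν' wf sc bA bB ΔA ΔB w) (wt : ℕ → ι → D → ℝ)
    (hwt : ∀ K τ, ∀ X ∈ wf K τ, 0 ≤ wt K τ X) {Cw : ℝ} (hCw : 0 ≤ Cw)
    (hM : ∀ K, ∀ τ ∈ T K, Multiplicity (wf K τ) (sc K) (wt K τ) Cw vol R.ne1.Λ K)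
    -- run A and run B read as two parameters of N14's dressed tower (n14-a's one-run identifications, verbatim)
    (pA : ℕ → ℝ → ℝ → R.ne1.P) (KA : ℕ → ℕ)
    (βA : ∀ (K : ℕ) (t : ℝ) (τ : ι) (s : ℝ), D → (R.ne1.𝒯.B (pA K t s) (KA K)).Birth)
    (hscA : ∀ K t τ s, ∀ X ∈ wf K τ, KA K - (R.ne1.𝒯.B (pA K t s) (KA K)).birthScale (βA K t τ s X) = K - sc K X)
    (hdomA : ∀ K (t : ℝ), |t| ≤ l₀ → ∀ τ ∈ T K \ Bad K t, ∀ s : ℝ, |s| ≤ l₀ → ∀ X ∈ wf K τ,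
      |ΔA K t τ s X| ≤ (R.ne1.𝒯.B (pA K t s) (KA K)).size (βA K t τ s X) (KA K) * wt K τ X)
    (pB : ℕ → ℝ → ℝ → R.ne1.P) (KB : ℕ → ℕ)
    (βB : ∀ (K : ℕ) (t : ℝ) (τ : ι) (s : ℝ), D → (R.ne1.𝒯.B (pB K t s) (KB K)).Birth)
    (hscB : ∀ K t τ s, ∀ X ∈ wf K τ, KB K - (R.ne1.𝒯.B (pB K t s) (KB K)).birthScale (βB K t τ s X) = K - sc K X)
    (hdomB : ∀ K (t : ℝ), |t| ≤ l₀ → ∀ τ ∈ T K \ Bad K t, ∀ s : ℝ, |s| ≤ l₀ → ∀ X ∈ wf K τ,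
      |ΔB K t τ s X| ≤ (R.ne1.𝒯.B (pB K t s) (KB K)).size (βB K t τ s X) (KB K) * wt K τ X)
    -- the record's coupling tables: (0.20)-runs of the datum, the box, the infrared pin, the β-window (N17's side letters)
    {g : ℕ → ℕ → ℝ} {gIR bβ : ℝ} {k₀β : ℕ} (hγ : 0 < R.u3.γ) (hbβ : 0 < bβ) (hρ0 : 0 < R.u3.ρ) (hρ1 : R.u3.ρ < 1)
    (hrun : ∀ K, RGEqH K Dt.βfun (g K)) (hbox : ∀ K i, i ≤ K → 0 < g K i ∧ g K i ≤ R.u3.γ) (hpin : ∀ K, g K K = gIR)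
    (hlo : EventualLowerH bβ R.u3.γ k₀β Dt.βfun)
    (hsmall : R.u3.cr * R.u3.C₉ * R.u3.ω * (((k₀β : ℝ) + 1) * R.u3.γ ^ 3 + 2 * R.u3.γ / bβ) ≤ (1 - R.u3.ρ) / 2)
    (hgW : ∀ K, g K ∈ R.u3.W) (hgW' : ∀ K, (fun i => g (K + 1) (i + 1)) ∈ R.u3.W)
    -- run B's functional: the first-coupling family through a selector
    (bsel : (ℕ → ℝ) → ℝ) (hb : ∀ s ∈ R.u3.W, 0 < bsel s ∧ bsel s ≤ R.u3.γ)
    -- the bracket (T) with its growth letter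
    {CU : (ℕ → ℝ) → ℕ → ℝ} (hU : LipBackground R.u3.EA R.u3.W R.u3.κ CU) {P : ℝ} {q : ℕ} (hG : PolyLipGrowth CU g P q)
    (hP : 0 ≤ P) (hκ : 0 ≤ R.u3.κ)
    -- N16's liaison letters on the readings family driving the backgrounds
    {ι' X' : Type} (Rd : Readings ι' X') {C₃ θ₃ : ℝ} (h3 : NE3Shape Rd C₃ θ₃) (hC₃ : 0 ≤ C₃)
    {uA : ℕ → ι' → R.u3.C.BgA} {uB : ℕ → ι' → R.u3.C.BgB} (hgd : GaugeDominated Rd uA uB)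
    -- the rate of the young half
    {ρ' : ℝ} (hρ' : max R.u3.ω R.u3.ρ < ρ') (hθ₃ρ : θ₃ ≤ ρ') (hρ'1 : ρ' < 1) (hρ'Λ : ρ' ≤ R.ne1.Λ)
    -- the slots' U3 domains and §3's uniform two-run domination
    (δ : ∀ (K : ℕ) (t : ℝ) (τ : ι) (s : ℝ), D → R.u3.C.Dom)
    (hδ : ∀ K t τ s, ∀ X ∈ wf K τ, R.u3.C.scale (δ K t τ s X) = sc K X)
    (hdomU : ∀ K (t : ℝ), |t| ≤ l₀ → ∀ τ ∈ T K \ Bad K t, ∀ s : ℝ, |s| ≤ l₀ → ∀ X ∈ wf K τ, ∀ M : ℝ, 0 ≤ M →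
      (∀ v ∈ Rd.dom, |R.u3.EA (g K) (uA K v) (δ K t τ s X)
          - R.u3.EB (bsel fun i => g (K + 1) (i + 1)) (fun i => g (K + 1) (i + 1)) (uB K v) (δ K t τ s X)| ≤ M) →
      |ΔB K t τ s X - ΔA K t τ s X| ≤ wt K τ X * M)
    (hvol : 0 ≤ vol) (hws : Summable w) :
    ∃ η : ℕ → ℝ, TiltedMeanMatching l₀ T Bad F ν F' ν' η ∧ Summable η := by
  have h17 : N17At Dt R.u3 := hrates.2.2.2.1
  have h18 : N18At R.u3 := hrates.2.2.2.2.1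
  have h22 : N22At R.u3 := hrates.2.2.2.2.2
  -- letter signs from (D4)
  obtain ⟨𝒜A, 𝒜B, rA, rB, -, -, -, -, -, -, -, hcr, hC₅, hθ, hω, hθρ, -⟩ := id hD4
  have hρρ' : R.u3.ρ ≤ ρ' := ((le_max_right _ _).trans hρ'.le)
  have hθρ' : R.u3.θ ≤ ρ' := hθρ.trans hρρ'
  have hρ'0 : 0 < ρ' := hρ0.trans_le hρρ'
  -- §1: the coupling bracket by name from N17 · (D4) · N18 · N22
  have hcpl := couplingBracket_of_n17At_readOutAt Dt R.u3 h17 hD4 h18 h22 hγ hbβ hρ0 hρ1 hrun hbox hpin hlo hsmall hρ'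
  set b : ℝ := R.u3.C₉ * (R.u3.γ ^ 3 * (2 * (R.u3.cr * R.u3.C₅ * R.u3.θ) / (1 - R.u3.ρ))) * (ρ' / (ρ' - max R.u3.ω R.u3.ρ))
    with hbdef
  have hb0 : 0 ≤ b := by
    have hC₉ : 0 ≤ R.u3.C₉ := T4TowerRateComposition.fadingMemory_const_nonneg h22.2
    have hCd : 0 ≤ 2 * (R.u3.cr * R.u3.C₅ * R.u3.θ) / (1 - R.u3.ρ) :=
      div_nonneg (mul_nonneg zero_le_two (mul_nonneg (mul_nonneg hcr hC₅) hθ)) (by linarith)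
    have hmax : 0 < ρ' - max R.u3.ω R.u3.ρ := sub_pos.mpr hρ'
    exact mul_nonneg (mul_nonneg hC₉ (mul_nonneg (pow_nonneg hγ.le 3) hCd)) (div_nonneg hρ'0.le hmax.le)
  -- §2: the argument bracket by name from the NE3 liaison letters
  obtain ⟨a, ha0, harg⟩ := argBracket_of_ne3Shape_gaugeDominated (Car := R.u3.C) Rd h3 hC₃ hgd hG hP hθ₃ρ
  -- NE5 for run B's selected family, worsened to `ρ′`
  have h5 : NE5 R.u3.EA (fun s => R.u3.EB (bsel s) s) R.u3.W R.u3.κ R.u3.θ R.u3.C₅ :=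
    fun s hs U X => h18 (bsel s) (hb s hs).1 (hb s hs).2 s hs U X
  have h5ρ : NE5 R.u3.EA (fun s => R.u3.EB (bsel s) s) R.u3.W R.u3.κ ρ' R.u3.C₅ := ne5_mono_rate h5 hθ hθρ' hC₅ le_rfl
  -- §3: the young rate on the readings family
  have hY : YoungInfluenceRate l₀ T Bad wf sc ΔA ΔB vol (Cw * (a + b + R.u3.C₅)) ρ' R.ne1.Λ :=
    youngInfluenceRate_of_readings (EB := fun s => R.u3.EB (bsel s) s) h22.1 hU h5ρ hκ wt hM δ hδ g
      (fun K i => g (K + 1) (i + 1)) hgW hgW' (fun K j hj => (hG K j hj).1) Rd.dom uA uB hdomU harg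
      (fun K j hj => (hcpl K j hj).trans_eq (by rw [hbdef])) ha0 hb0 hC₅ hρ'0.le
  -- n14-a's capstone with `hY` fed
  exact YMDAG.N14.tiltedMeanMatching_summable_of_n14 hrates.1 hL wt hwt hM hCw pA KA βA hscA hdomA pB KB βB hscB hdomB hY hvol
    hρ'0 hρ'1 hρ'Λ hws

/-- **THE SAME WITH N16 ITSELF BY NAME** [bookkeeping] — `RatesAt Dt R` read at `.1` (N14), `.2.2.1` (N16), `.2.2.2.1` (N17), `.2.2.2.2.1` (N18),
`.2.2.2.2.2` (N22): five of six, as on road (i) (`N19RateEdgeByName.rateEdge_of_linkReading_byName`; `N15At` = NE2 feeds NE3's producer side, not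
this edge).  The NE3 liaison letters of `tiltedMeanMatching_summable_of_ratesAt_liaison` are PRODUCED by n19-a's
`N19InEdgesAtRecord.ne3Liaison_of_covRoot` from `N16At R.ne3` read with `R.ne3.g = gradConst 4 c′` and its displayed inputs, listed verbatim:
THE END's regime letters of `R.ne3`, N07's interface `LeafH3sup`, the record's regular minimiser selection `sel`, NE7 route-#1's numeric side
letters (`θ⁶ = L⁻¹`, `γ₃`, `l₁`, fit), the target rate `θ₃` (`L⁻¹ ≤ θ₃`, `θ⁸ ≤ θ₃ < 1`), the reading map `rd` with the action-reading
identification and `Nper⁴ ≤ Rd.vol`, the offset `k₀ ≥ 1`, and the gauge-domination convention.  Nothing of N16 ∕ N07 is proved. [folklore] -/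
theorem tiltedMeanMatching_summable_of_ratesAt_byName (Dt : YMDAG.UVSplit.Datum Fam N) (R : RateCarriers N)
    (hrates : RatesAt Dt R) (hD4 : ReadOutAt Dt R.u3)
    (hL : ScaleLedger l₀ T Bad F ν F' ν' wf sc bA bB ΔA ΔB w) (wt : ℕ → ι → D → ℝ)
    (hwt : ∀ K τ, ∀ X ∈ wf K τ, 0 ≤ wt K τ X) {Cw : ℝ} (hCw : 0 ≤ Cw)
    (hM : ∀ K, ∀ τ ∈ T K, Multiplicity (wf K τ) (sc K) (wt K τ) Cw vol R.ne1.Λ K)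
    (pA : ℕ → ℝ → ℝ → R.ne1.P) (KA : ℕ → ℕ)
    (βA : ∀ (K : ℕ) (t : ℝ) (τ : ι) (s : ℝ), D → (R.ne1.𝒯.B (pA K t s) (KA K)).Birth)
    (hscA : ∀ K t τ s, ∀ X ∈ wf K τ, KA K - (R.ne1.𝒯.B (pA K t s) (KA K)).birthScale (βA K t τ s X) = K - sc K X)
    (hdomA : ∀ K (t : ℝ), |t| ≤ l₀ → ∀ τ ∈ T K \ Bad K t, ∀ s : ℝ, |s| ≤ l₀ → ∀ X ∈ wf K τ,
      |ΔA K t τ s X| ≤ (R.ne1.𝒯.B (pA K t s) (KA K)).size (βA K t τ s X) (KA K) * wt K τ X)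
    (pB : ℕ → ℝ → ℝ → R.ne1.P) (KB : ℕ → ℕ)
    (βB : ∀ (K : ℕ) (t : ℝ) (τ : ι) (s : ℝ), D → (R.ne1.𝒯.B (pB K t s) (KB K)).Birth)
    (hscB : ∀ K t τ s, ∀ X ∈ wf K τ, KB K - (R.ne1.𝒯.B (pB K t s) (KB K)).birthScale (βB K t τ s X) = K - sc K X)
    (hdomB : ∀ K (t : ℝ), |t| ≤ l₀ → ∀ τ ∈ T K \ Bad K t, ∀ s : ℝ, |s| ≤ l₀ → ∀ X ∈ wf K τ,
      |ΔB K t τ s X| ≤ (R.ne1.𝒯.B (pB K t s) (KB K)).size (βB K t τ s X) (KB K) * wt K τ X)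
    {g : ℕ → ℕ → ℝ} {gIR bβ : ℝ} {k₀β : ℕ} (hγ : 0 < R.u3.γ) (hbβ : 0 < bβ) (hρ0 : 0 < R.u3.ρ) (hρ1 : R.u3.ρ < 1)
    (hrun : ∀ K, RGEqH K Dt.βfun (g K)) (hbox : ∀ K i, i ≤ K → 0 < g K i ∧ g K i ≤ R.u3.γ) (hpin : ∀ K, g K K = gIR)
    (hlo : EventualLowerH bβ R.u3.γ k₀β Dt.βfun)
    (hsmall : R.u3.cr * R.u3.C₉ * R.u3.ω * (((k₀β : ℝ) + 1) * R.u3.γ ^ 3 + 2 * R.u3.γ / bβ) ≤ (1 - R.u3.ρ) / 2)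
    (hgW : ∀ K, g K ∈ R.u3.W) (hgW' : ∀ K, (fun i => g (K + 1) (i + 1)) ∈ R.u3.W)
    (bsel : (ℕ → ℝ) → ℝ) (hb : ∀ s ∈ R.u3.W, 0 < bsel s ∧ bsel s ≤ R.u3.γ)
    {CU : (ℕ → ℝ) → ℕ → ℝ} (hU : LipBackground R.u3.EA R.u3.W R.u3.κ CU) {P : ℝ} {q : ℕ} (hG : PolyLipGrowth CU g P q)
    (hP : 0 ≤ P) (hκ : 0 ≤ R.u3.κ)
    -- N16 BY NAME: THE END's regime letters of `R.ne3`, N07's interface, the selection, NE7 route-#1's side letters, the target rate,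
    -- the reading map with the action-reading identification, the offset, the gauge-domination convention (`ne3Liaison_of_covRoot`'s inputs)
    {c' t ε₁ θ γ₃ l₁ θ₃ : ℝ} (hg3 : R.ne3.g = gradConst 4 c') (hL2 : 2 ≤ R.ne3.L) (hNper : 1 ≤ R.ne3.Nper) (hb3 : 0 ≤ R.ne3.b)
    (hc' : 0 ≤ c') (hbt : R.ne3.b ≤ t) (hct : c' ≤ t) (hC3 : 0 ≤ R.ne3.C) (hsmall3 : (2 : ℝ) ^ 91 * (R.ne3.L : ℝ) ^ 17 * t ≤ 1)
    (hεt : (2 : ℝ) ^ 76 * (R.ne3.L : ℝ) ^ 12 * t ≤ R.ne3.ε) (hε1 : 16 * B7Prop2Explicit.C0 4 * R.ne3.ε ≤ 3)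
    (hε2 : 1024 * (4 + 1) * (4 + 4) * (R.ne3.L : ℝ) ^ 2 * R.ne3.ε ≤ 1) (hε₁ : ε₁ ≤ 1 / 4) (hε₁b : ε₁ ≤ R.ne3.b) (hε₁c : 4 * ε₁ ≤ c')
    (hdom3 : R.ne3.dom ⊆ sfClass 4 R.ne3.L R.ne3.Nper ε₁ 0) (hH3 : LeafH3sup 4 R.ne3.L R.ne3.Nper R.ne3.ε R.ne3.b c' R.ne3.dom)
    (sel : ℕ → (B7Prop1Explicit.Site 4 → Fin 4 → (Matrix (Fin N) (Fin N) ℂ)ˣ) → (B7Prop1Explicit.Site 4 → Fin 4 → (Matrix (Fin N) (Fin N) ℂ)ˣ))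
    (hsel : ∀ V ∈ R.ne3.dom, ∀ k : ℕ, IsMinimiser 4 (sfClass 4 R.ne3.L R.ne3.Nper R.ne3.ε) R.ne3.L R.ne3.Nper k V (sel k V))
    (hreg : ∀ V ∈ R.ne3.dom, ∀ k : ℕ, RegularSup 4 R.ne3.L R.ne3.Nper R.ne3.b c' k (sel k V))
    (hθ0 : 0 < θ) (hθ6 : θ ^ 6 = ((R.ne3.L : ℝ))⁻¹) (hΛ₂' : 0 < R.ne3.Λ₂') (hγ₃ : 0 < γ₃)
    (hγ3 : R.ne3.C * (wallConst 4 R.ne3.L * (R.ne3.Nper : ℝ) ^ 2 *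
      (Real.sqrt (gradConst 4 c') * dualC2 4 R.ne3.L + 2 * R.ne3.b ^ 2 * dualC1 4 R.ne3.L)) ≤ γ₃ ^ 3)
    (hl₁ : 0 < l₁) (hΛl₁ : R.ne3.Λ₁ ≤ l₁ ^ 3) (hfit : γ₃ * θ ^ 2 ≤ l₁ * R.ne3.Nper)
    (hθ₃L : ((R.ne3.L : ℝ))⁻¹ ≤ θ₃) (hθ₃θ : θ ^ 8 ≤ θ₃) (hθ₃1 : θ₃ < 1)
    {ι' X' : Type} (Rd : Readings ι' X') (rd : ι' → (B7Prop1Explicit.Site 4 → Fin 4 → (Matrix (Fin N) (Fin N) ℂ)ˣ))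
    (hrd : ∀ v ∈ Rd.dom, rd v ∈ R.ne3.dom)
    (hact : ∀ k, ∀ v ∈ Rd.dom, Rd.act k v = minAct 4 (sfClass 4 R.ne3.L R.ne3.Nper R.ne3.ε) R.ne3.L R.ne3.Nper k (rd v))
    (hvol3 : (R.ne3.Nper : ℝ) ^ 4 ≤ Rd.vol) (uA : ℕ → ι' → R.u3.C.BgA) (uB : ℕ → ι' → R.u3.C.BgB) {k₀ : ℕ} (hk₀ : 1 ≤ k₀)
    (hdomc : ∀ K : ℕ, ∀ v ∈ Rd.dom, ∀ (u : B7Prop1Explicit.Site 4 → (Matrix (Fin N) (Fin N) ℂ)ˣ)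
      (Z : B7Prop1Explicit.Site 4 → Fin 4 → Matrix (Fin N) (Fin N) ℂ) (M : ℝ),
      IsUnitarySite u → IsPeriodicSite u ((R.ne3.Nper * R.ne3.L ^ (k₀ + K) : ℕ) : ℤ) → T4AveragingDeficitWall.IsSkewDir Z →
      IsPeriodicDir Z ((R.ne3.Nper * R.ne3.L ^ (k₀ + K) : ℕ) : ℤ) →
      B7Prop1Explicit.gaugeAct u (sel (k₀ + K) (rd v)) =
        T4AveragingDeficitWall.vary (B7Prop2Explicit.rescale R.ne3.L (B7Prop1Explicit.bavg R.ne3.L (sel (k₀ + K + 1) (rd v)))) Z 1 →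
      (∀ (x : B7Prop1Explicit.Site 4) (κ : Fin 4), ‖Z x κ‖ ≤ M) → R.u3.C.gauge (uA K v) (R.u3.C.transport (uB K v)) ≤ M)
    -- the rate of the young half
    {ρ' : ℝ} (hρ' : max R.u3.ω R.u3.ρ < ρ') (hθ₃ρ : θ₃ ≤ ρ') (hρ'1 : ρ' < 1) (hρ'Λ : ρ' ≤ R.ne1.Λ)
    -- the slots' U3 domains and §3's uniform two-run domination
    (δ : ∀ (K : ℕ) (t : ℝ) (τ : ι) (s : ℝ), D → R.u3.C.Dom)
    (hδ : ∀ K t τ s, ∀ X ∈ wf K τ, R.u3.C.scale (δ K t τ s X) = sc K X)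
    (hdomU : ∀ K (t : ℝ), |t| ≤ l₀ → ∀ τ ∈ T K \ Bad K t, ∀ s : ℝ, |s| ≤ l₀ → ∀ X ∈ wf K τ, ∀ M : ℝ, 0 ≤ M →
      (∀ v ∈ Rd.dom, |R.u3.EA (g K) (uA K v) (δ K t τ s X)
          - R.u3.EB (bsel fun i => g (K + 1) (i + 1)) (fun i => g (K + 1) (i + 1)) (uB K v) (δ K t τ s X)| ≤ M) →
      |ΔB K t τ s X - ΔA K t τ s X| ≤ wt K τ X * M)
    (hvol : 0 ≤ vol) (hws : Summable w) :
    ∃ η : ℕ → ℝ, TiltedMeanMatching l₀ T Bad F ν F' ν' η ∧ Summable η := by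
  haveI : Nonempty (Fin N) := ⟨⟨0, Nat.pos_of_ne_zero (NeZero.ne N)⟩⟩
  -- N16 from `RatesAt Dt R` by name, read with `R.ne3.g = gradConst 4 c′`
  have h16 : NE3EnergyWeightedCovShape.NE3EnergyRateWCov 4 (sfClass 4 R.ne3.L R.ne3.Nper R.ne3.ε) R.ne3.L R.ne3.Nper R.ne3.b
      (gradConst 4 c') R.ne3.C R.ne3.Λ₁ R.ne3.Λ₂' R.ne3.dom := by
    rw [← hg3]; exact hrates.2.2.1
  obtain ⟨C₃, loc, hC₃, h3, hgd⟩ :=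
    ne3Liaison_of_covRoot (n := Fin N) hL2 hNper hb3 hc' hbt hct hC3 hsmall3 hεt hε1 hε2 hε₁ hε₁b hε₁c hdom3 h16 hH3 sel hsel hreg
      hθ0 hθ6 hΛ₂' hγ₃ hγ3 hl₁ hΛl₁ hfit hθ₃L hθ₃θ hθ₃1 Rd rd hrd hact hvol3 uA uB hk₀ hdomc
  exact tiltedMeanMatching_summable_of_ratesAt_liaison Dt R hrates hD4 hL wt hwt hCw hM pA KA βA hscA hdomA pB KB βB hscB hdomB
    hγ hbβ hρ0 hρ1 hrun hbox hpin hlo hsmall hgW hgW' bsel hb hU hG hP hκ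
    (⟨Rd.dom, Rd.act, loc, Rd.vol, Rd.vol_nonneg⟩ : Readings ι' Unit) h3 hC₃ hgd hρ' hθ₃ρ hρ'1 hρ'Λ δ hδ hdomU hvol hws

end Capstone

end YMDAG.N14YoungRate

end
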